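import Summits.PneNP.PneNP.Theorems.OneSliceConstantBandDefs
import Summits.PneNP.PneNP.Theorems.OneSliceConstantBandRelMintermStepAux

/-!
# Route OneSlice, crux `ConstantBand` (stmt-PneNP-2834), line `flat-prior-relative-minterms`: stub S3

`stub_relMintermStep : NearCliqueContiguity → RelMintermPlanted` — the relative-minterm step (Rossman
FOCS'10 Lemma 15 at ONE law, relativised): near-clique contiguity, a union bound over the `C(k,2)` maximal
proper sub-plantings `x ∪ (K_A − e)`, monotonicity and a telescoping ("flat prior") sum give: if a monotone
`f` accepts almost all planted pairs from the lower band but rejects half the band, then `K_A` is a relative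
minterm of `f` at `x` for at least a `(1/2 − 2γ)`-fraction of the lower-band pairs. Pure finite counting;
the combinatorial and counting toolkit is `OneSliceConstantBandRelMintermStepAux.lean` (prefix `rms_`).
-/

namespace Summit.PneNP.PneNP.Cruxes.ConstantBand.FlatPriorRelativeMinterms

open Literature.Computability.Complexity Finset Filter Classical

set_option linter.dupNamespace false

section RelMintermStep

variable {n : ℕ}

/-! ## The counting fractions of the line: bookkeeping -/

/-- **Key combinatorial lemma** in the line's vocabulary: for monotone `f`, if `f(x) = 0`, `f(x ∪ K_A) = 1`
and every maximal proper sub-planting `x ∪ (K_A − e)` (`e ∈ K_A`) is rejected, then `K_A` is a relative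
minterm of `f` at `x`. [folklore] -/
theorem rms_isRelMinterm_of_good {f : (Edge n → Bool) → Bool} (hf : Monotone f) {x : Edge n → Bool}
    {A : Finset (Fin n)} (h0 : f x = false) (h1 : f (plantClique A x) = true)
    (h2 : ∀ e ∈ edgesIn A, f (plantSub A e x) = false) : IsRelMinterm f x A :=
  ⟨h0, h1, fun _ hxy hyp hne => rms_relMinterm_of_good hf h2 hxy hyp hne⟩

/-- Slice probabilities are at most one. [folklore] -/
theorem rms_sliceProb_le_one (n i : ℕ) (P : (Edge n → Bool) → Prop) : sliceProb n i P ≤ 1 := by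
  unfold sliceProb
  exact div_le_one_of_le₀ (by exact_mod_cast card_le_card (filter_subset _ _)) (Nat.cast_nonneg _)

/-- Slice probabilities of equivalent events agree. [folklore] -/
theorem rms_sliceProb_congr {n i : ℕ} {P Q : (Edge n → Bool) → Prop} (h : ∀ x, P x ↔ Q x) :
    sliceProb n i P = sliceProb n i Q := by
  unfold sliceProb
  rw [filter_congr fun x _ => h x]

/-- Triple probabilities of equivalent events agree. [folklore] -/
theorem rms_tripleProb_congr {n k i : ℕ} {P Q : (Edge n → Bool) → Finset (Fin n) → Edge n → Prop}
    (h : ∀ x A e, P x A e ↔ Q x A e) : tripleProb n k i P = tripleProb n k i Q := by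
  unfold tripleProb
  rw [filter_congr fun t _ => and_congr_right fun _ => h _ _ _]

/-- Monotonicity of the planted-pair measure in the event. [folklore] -/
theorem rms_pairProb_mono {n k i : ℕ} {P Q : (Edge n → Bool) → Finset (Fin n) → Prop}
    (h : ∀ x A, P x A → Q x A) : pairProb n k i P ≤ pairProb n k i Q := by
  unfold pairProb
  refine div_le_div_of_nonneg_right ?_ (by positivity)
  exact_mod_cast rms_card_filter_mono (S := slice n i ×ˢ powersetCard k (univ : Finset (Fin n)))
    fun xa => h xa.1 xa.2

/-- Sub-additivity of the planted-pair measure under a three-way cover. [folklore] -/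
theorem rms_pairProb_le_add3 {n k i : ℕ} {P Q₁ Q₂ Q₃ : (Edge n → Bool) → Finset (Fin n) → Prop}
    (h : ∀ x A, P x A → Q₁ x A ∨ Q₂ x A ∨ Q₃ x A) :
    pairProb n k i P ≤ pairProb n k i Q₁ + pairProb n k i Q₂ + pairProb n k i Q₃ := by
  unfold pairProb
  rw [← add_div, ← add_div]
  refine div_le_div_of_nonneg_right ?_ (by positivity)
  exact_mod_cast rms_card_filter_cover3 (S := slice n i ×ˢ powersetCard k (univ : Finset (Fin n)))
    fun xa => h xa.1 xa.2

/-- An event depending on `x` only: its planted-pair probability is its slice probability (`k ≤ n`).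
[folklore] -/
theorem rms_pairProb_fst {n k i : ℕ} (hkn : k ≤ n) (Q : (Edge n → Bool) → Prop) :
    pairProb n k i (fun x _ => Q x) = sliceProb n i Q := by
  have hC : ((n.choose k : ℕ) : ℝ) ≠ 0 := by exact_mod_cast (Nat.choose_pos hkn).ne'
  simp only [pairProb, sliceProb]
  rw [rms_card_filter_fst n k i Q, Nat.cast_mul, mul_div_mul_right _ _ hC]

/-- An event not depending on the edge `e`: its triple probability is its pair probability (`k ≥ 2`).
[folklore] -/
theorem rms_tripleProb_fst {n k i : ℕ} (hk : 2 ≤ k) (Q : (Edge n → Bool) → Finset (Fin n) → Prop) :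
    tripleProb n k i (fun x A _ => Q x A) = pairProb n k i Q := by
  have hK : ((k.choose 2 : ℕ) : ℝ) ≠ 0 := by exact_mod_cast (Nat.choose_pos hk).ne'
  simp only [tripleProb, pairProb]
  rw [rms_card_filter_triple n k i Q, Nat.cast_mul, mul_div_mul_right _ _ hK]

/-- **Union bound** over the `C(k,2)` edges of `K_A`:
`P_{(x,A)}[∃ e ∈ K_A, Q] ≤ C(k,2) · P_{(x,A,e)}[Q]`. [folklore] -/
theorem rms_pairProb_exists_le {n k i : ℕ} (hk : 2 ≤ k)
    (Q : (Edge n → Bool) → Finset (Fin n) → Edge n → Prop) :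
    pairProb n k i (fun x A => ∃ e ∈ edgesIn A, Q x A e) ≤
      (k.choose 2 : ℝ) * tripleProb n k i Q := by
  simp only [tripleProb, pairProb]
  exact rms_shadow_div_le hk Q _ _ (by positivity)

/-- Difference rule for nested events of the triple measure. [folklore] -/
theorem rms_tripleProb_and_not {n k i : ℕ}
    {P Q : (Edge n → Bool) → Finset (Fin n) → Edge n → Prop} (h : ∀ x A e, P x A e → Q x A e) :
    tripleProb n k i (fun x A e => Q x A e ∧ ¬ P x A e) =
      tripleProb n k i Q - tripleProb n k i P := by
  simp only [tripleProb]
  rw [← sub_div]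
  congr 1
  rw [eq_sub_iff_add_eq]
  exact_mod_cast rms_card_filter_and_not
    (S := (slice n i ×ˢ powersetCard k (univ : Finset (Fin n))) ×ˢ (univ : Finset (Edge n)))
    (E := fun t => t.2 ∈ edgesIn t.1.2) (P := fun t => P t.1.1 t.1.2 t.2)
    (Q := fun t => Q t.1.1 t.1.2 t.2) fun t => h _ _ _

/-! ## The per-slice bound -/

/-- **Per-slice lower bound** (inclusion–exclusion + union bound + monotonicity), monotone `f`, `2 ≤ k ≤ n`:
`P_i[relminterm] ≥ P_i[f(x)=0] − P_i[f(x ∪ K_A)=0] − C(k,2)·(P_i[f(x ∪ (K_A−e))=1] − P_i[f(x)=1])`.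
[folklore] -/
theorem rms_perSlice {n k i : ℕ} (hkn : k ≤ n) (hk : 2 ≤ k) {f : (Edge n → Bool) → Bool}
    (hf : Monotone f) :
    sliceProb n i (fun x => f x = false) -
        pairProb n k i (fun x A => f (plantClique A x) = false) -
        (k.choose 2 : ℝ) * (tripleProb n k i (fun x A e => f (plantSub A e x) = true) -
          sliceProb n i (fun x => f x = true)) ≤
      pairProb n k i (IsRelMinterm f) := by
  -- (1) Good ⊆ IsRelMinterm
  have h1 : pairProb n k i (fun x A => f x = false ∧ f (plantClique A x) = true ∧
      ∀ e ∈ edgesIn A, f (plantSub A e x) = false) ≤ pairProb n k i (IsRelMinterm f) :=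
    rms_pairProb_mono fun x A h => rms_isRelMinterm_of_good hf h.1 h.2.1 h.2.2
  -- (2) three-way cover of `f x = 0`
  have h2 : pairProb n k i (fun x _ => f x = false) ≤
      pairProb n k i (fun x A => f x = false ∧ f (plantClique A x) = true ∧
          ∀ e ∈ edgesIn A, f (plantSub A e x) = false) +
        pairProb n k i (fun x A => f (plantClique A x) = false) +
        pairProb n k i (fun x A => ∃ e ∈ edgesIn A, f x = false ∧ f (plantSub A e x) = true) := by
    refine rms_pairProb_le_add3 fun x A hx => ?_
    by_cases hc : f (plantClique A x) = true
    · by_cases he : ∃ e ∈ edgesIn A, f (plantSub A e x) = true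
      · exact he.elim fun e he => Or.inr (Or.inr ⟨e, he.1, hx, he.2⟩)
      · push Not at he
        exact Or.inl ⟨hx, hc, fun e he' => by simpa using he e he'⟩
    · exact Or.inr (Or.inl (by simpa using hc))
  have h3 : pairProb n k i (fun x _ => f x = false) = sliceProb n i (fun x => f x = false) :=
    rms_pairProb_fst hkn _
  have h4 : pairProb n k i (fun x A => ∃ e ∈ edgesIn A, f x = false ∧ f (plantSub A e x) = true) ≤
      (k.choose 2 : ℝ) *
        tripleProb n k i (fun x A e => f x = false ∧ f (plantSub A e x) = true) :=
    rms_pairProb_exists_le hk _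
  -- (3) monotonicity: `f x = 1 ⇒ f (x ∪ (K_A − e)) = 1`
  have h5 : tripleProb n k i (fun x A e => f x = false ∧ f (plantSub A e x) = true) =
      tripleProb n k i (fun x A e => f (plantSub A e x) = true) -
        tripleProb n k i (fun x _ _ => f x = true) := by
    rw [← rms_tripleProb_and_not (P := fun x _ _ => f x = true)
      (Q := fun x A e => f (plantSub A e x) = true) ?_]
    · refine rms_tripleProb_congr fun x A e => ?_
      simp only [Bool.not_eq_true]
      exact and_comm
    · intro x A e hxe
      have hm := hf (rms_le_plantSub A e x)
      rw [hxe] at hm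
      exact Bool.le_iff_imp.1 hm rfl
  have h6 : tripleProb n k i (fun x _ _ => f x = true) = sliceProb n i (fun x => f x = true) :=
    (rms_tripleProb_fst hk _).trans (rms_pairProb_fst hkn _)
  rw [h5, h6] at h4
  linarith

/-! ## Bands -/

/-- The lower band sits inside the band. [folklore] -/
theorem rms_lowerBand_subset (k j w : ℕ) : lowerBand k j w ⊆ band j w :=
  rms_Icc_lower_subset _ _ _

/-- The band exceeds the lower band by at most `C(k,2)` slices. [folklore] -/
theorem rms_card_band_sdiff_le (k j w : ℕ) : #(band j w \ lowerBand k j w) ≤ k.choose 2 :=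
  rms_card_Icc_sdiff_le _ _ _

/-- The lower band has at least `w + 1 − C(k,2)` slices. [folklore] -/
theorem rms_card_lowerBand_ge (k j w : ℕ) : w + 1 - k.choose 2 ≤ #(lowerBand k j w) :=
  rms_card_Icc_lower_ge _ _ _

end RelMintermStep

/-! ## The stub -/

/-- **S3 · the relative-minterm step** (Rossman FOCS'10 Lemma 15 at one law, relativised): near-clique
contiguity implies `RelMintermPlanted`. With `K = C(k,2)`, `ε = γ/(2K)`, `w₀ = K + ⌈2K²/γ⌉₊`: per slice
`P_i[relminterm] ≥ P_i[f=0] − P_i[f(x∪K_A)=0] − K·(P_{i+K−1}[f=1] + ε − P_i[f=1])` (key lemma + union bound +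
monotonicity + contiguity); summed over the lower band the `P[f=1]` terms telescope to `≤ K − 1`
(flat prior) and the two band hypotheses give `(1/2 − 2γ)·#lower`. [folklore] -/
theorem stub_relMintermStep : NearCliqueContiguity → RelMintermPlanted := by
  intro hNCC k hk γ hγ
  have hK3 : 3 ≤ k.choose 2 := le_trans (by decide) (Nat.choose_le_choose 2 hk)
  have hKpos : (0 : ℝ) < k.choose 2 := by exact_mod_cast (show 0 < k.choose 2 by omega)
  refine ⟨k.choose 2 + ⌈2 * (k.choose 2 : ℝ) ^ 2 / γ⌉₊, fun w hw => ?_⟩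
  have hε : 0 < γ / (2 * k.choose 2) := by positivity
  filter_upwards [hNCC k hk w (γ / (2 * k.choose 2)) hε, eventually_ge_atTop k] with n hn hkn j hj f hf
    hplant hhalf
  have hk2 : 2 ≤ k := by omega
  -- per-slice bound + contiguity, for every lower-band slice
  have hper : ∀ i ∈ lowerBand k j w,
      sliceProb n i (fun x => f x = false) - pairProb n k i (fun x A => f (plantClique A x) = false) -
        (k.choose 2 : ℝ) * (sliceProb n (i + (k.choose 2 - 1)) (fun x => f x = true) +
          γ / (2 * k.choose 2) - sliceProb n i (fun x => f x = true)) ≤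
      pairProb n k i (IsRelMinterm f) := by
    intro i hi
    have hcont := hn j hj i (rms_lowerBand_subset k j w hi) (univ.filter fun y => f y = true)
    have e1 : tripleProb n k i (fun x A e => f (plantSub A e x) = true) =
        tripleProb n k i (fun x A e => plantSub A e x ∈ univ.filter fun y => f y = true) :=
      rms_tripleProb_congr fun x A e => by simp
    have e2 : sliceProb n (i + k.choose 2 - 1) (fun y => y ∈ univ.filter fun y => f y = true) =
        sliceProb n (i + (k.choose 2 - 1)) (fun x => f x = true) := by
      rw [show i + k.choose 2 - 1 = i + (k.choose 2 - 1) by omega]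
      exact rms_sliceProb_congr fun x => by simp
    rw [← e1, e2] at hcont
    have hps := rms_perSlice (i := i) hkn hk2 hf
    have hmul : (k.choose 2 : ℝ) * (tripleProb n k i (fun x A e => f (plantSub A e x) = true) -
        sliceProb n i (fun x => f x = true)) ≤
        (k.choose 2 : ℝ) * (sliceProb n (i + (k.choose 2 - 1)) (fun x => f x = true) +
          γ / (2 * k.choose 2) - sliceProb n i (fun x => f x = true)) :=
      mul_le_mul_of_nonneg_left (by linarith) hKpos.le
    linarith
  -- flat prior
  have htel : ∑ i ∈ lowerBand k j w, (sliceProb n (i + (k.choose 2 - 1)) (fun x => f x = true) -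
      sliceProb n i (fun x => f x = true)) ≤ (k.choose 2 : ℝ) - 1 := by
    have h := rms_sum_Icc_shift_sub_le (fun i => sliceProb n i (fun x => f x = true))
      (fun t => div_nonneg (Nat.cast_nonneg _) (Nat.cast_nonneg _))
      (fun t => rms_sliceProb_le_one _ _ _) (j - w) (j + w - k.choose 2) (k.choose 2 - 1)
    rw [Nat.cast_sub (by omega), Nat.cast_one] at h
    exact h
  -- band versus lower band
  have hband : ∑ i ∈ band j w, sliceProb n i (fun x => f x = false) - k.choose 2 ≤
      ∑ i ∈ lowerBand k j w, sliceProb n i (fun x => f x = false) := by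
    have hsd := sum_sdiff (f := fun i => sliceProb n i fun x => f x = false)
      (rms_lowerBand_subset k j w)
    have hle : ∑ i ∈ band j w \ lowerBand k j w, sliceProb n i (fun x => f x = false) ≤
        (k.choose 2 : ℝ) := by
      calc ∑ i ∈ band j w \ lowerBand k j w, sliceProb n i (fun x => f x = false)
          ≤ ∑ _i ∈ band j w \ lowerBand k j w, (1 : ℝ) :=
            sum_le_sum fun i _ => rms_sliceProb_le_one _ _ _
        _ = #(band j w \ lowerBand k j w) := by rw [sum_const, nsmul_eq_mul, mul_one]
        _ ≤ _ := by exact_mod_cast rms_card_band_sdiff_le k j w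
    linarith
  -- cardinalities
  have hIB : (#(lowerBand k j w) : ℝ) ≤ #(band j w) := by
    exact_mod_cast card_le_card (rms_lowerBand_subset k j w)
  have hcardI : ⌈2 * (k.choose 2 : ℝ) ^ 2 / γ⌉₊ ≤ #(lowerBand k j w) := by
    have := rms_card_lowerBand_ge k j w
    omega
  have hI : 2 * (k.choose 2 : ℝ) ^ 2 ≤ γ * #(lowerBand k j w) := by
    have h1 : 2 * (k.choose 2 : ℝ) ^ 2 / γ ≤ #(lowerBand k j w) :=
      (Nat.le_ceil _).trans (by exact_mod_cast hcardI)
    rw [div_le_iff₀ hγ] at h1; linarith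
  have hKε : (k.choose 2 : ℝ) * (γ / (2 * k.choose 2)) = γ / 2 := by field_simp
  exact rms_assemble hper htel hband hplant hhalf hIB hI hKε hKpos.le

end Summit.PneNP.PneNP.Cruxes.ConstantBand.FlatPriorRelativeMinterms
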